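import Literature.AlgebraicGeometry.Resolution.BlowupsIntegral
import Literature.AlgebraicGeometry.Resolution.MarkedIdealsLemmas
import HarnessLib

/-!
# Blowing up in a product of ideals (Stacks 080A) and its ingredients

Topic: `Literature/AlgebraicGeometry/Resolution`. A step in the decomposition of the named fact
`Temkin2008_prop234` (`Temkin2008Localization.lean`; Temkin 2008, Prop. 2.3.4, localization of
desingularization): the proof of Prop. 2.3.4 composes two blow-ups and needs the composite to be
a single blow-up with controlled centre — Temkin's Lemma 2.1.4 (Raynaud; Stacks, Tag 080B),
isolated as the hypothesis `hcomp` of `temkin2008_prop234_of_comp`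
(`Temkin2008LocalizationProofs.lean`). Stacks proves 080B from three ingredients: blowing up in
a product of ideals (Tag 080A), twisting a centre by a power of the exceptional divisor, and the
relative ampleness of `𝒪_{X'}(1)`. This file PROVES the first two, for blow-ups in the sense of
the universal property (`IsBlowup`, `Blowups.lean`, Görtz–Wedhorn Def. 13.90) and WITHOUT
recourse to the `Proj` construction, together with the facts on effective Cartier divisors they
rest on:

* `IsEffectiveCartier.mul`, `IsEffectiveCartier.pow` — sums of effective Cartier divisors
  (products of the ideal sheaves) are effective Cartier (Stacks 01WU);
* `Ideal.exists_local_generators_of_mul_eq_span` — the algebra lemma Stacks 09ME in explicit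
  form (`IJ = (f)`, `f` regular ⇒ `f = ∑ xᵢyᵢ`, `xᵢyᵢ = cᵢf`, `∑ cᵢ = 1`, and `I = (xᵢ)` with
  `xᵢ` regular in `A[1/cᵢ]`);
* `IsEffectiveCartier.of_mul_left` / `of_mul_right` — **if `𝓘𝓙` is an effective Cartier divisor
  then so are `𝓘` and `𝓙`** (Stacks 07ZV; no finiteness hypotheses);
* `map_mem_nonZeroDivisors_of_le_affine` — a regular element of `Γ(X, U)`, `U` affine, stays
  regular on every open `O ⊆ U`; `mem_nonZeroDivisors_of_injective`;
* `IsEffectiveCartier.comap_of_isBlowup` — **effective Cartier divisors pull back to effective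
  Cartier divisors along blowing ups** (Stacks 0809), from the universal property: a Cartier
  chart of the exceptional divisor injects into the sections over the basic open of its
  equation, which lies over the complement of the centre where the blowing up is an open
  immersion (`BlowupsIntegral.lean`);
* `IsBlowup.mul_of_isEffectiveCartier` — **twisting the centre by an effective Cartier divisor of
  the base does not change the blowing up** (`IsBlowup π K → IsEffectiveCartier L →
  IsBlowup π (K * L)`; the step of Stacks 080B quoting 0807 + 080A);
* `IsBlowup.comp` — **Stacks 080A, blowing up in a product**: `IsBlowup p P →
  IsBlowup p' (R.comap p) → IsBlowup (p' ≫ p) (P * R)`.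

What remains for Lemma 2.1.4 / Stacks 080B in the Noetherian case is the relative ampleness
statement "for an ideal `𝓚 ⊆ 𝒪_{X'}` there are `d` and `𝓙 ⊆ 𝒪_X` with
`p⁻¹𝓙 𝒪_{X'} = 𝓚 · 𝓘_E^d`" (the displayed formula in the proof of 080B), a computation on the
charts of `Proj ⨁ Iⁿ`, left to a sibling file.

## Sources

* The Stacks Project: Tag 01WR/01WS (effective Cartier divisors), Tag 01WT/01WU (sums),
  Tag 07ZV (= Lemma 31.13.9 label `divisors-lemma-sum-closed-subschemes-effective-Cartier`),
  Tag 09ME (`algebra-lemma-product-ideals-principal`), Tag 0809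
  (`divisors-lemma-blow-up-pullback-effective-Cartier`), Tag 080A
  (`divisors-lemma-blowing-up-two-ideals`), Tag 080B
  (`divisors-lemma-composition-finite-type-blowups`) — statements and proofs read from
  `divisors.tex` / `algebra.tex` of the Stacks project repository (labels ↔ tags from
  `tags/tags`). [StacksProject]
* M. Temkin, *Desingularization of quasi-excellent schemes in characteristic zero*, Adv. Math.
  219 (2008) = arXiv:math/0703678, Lemma 2.1.4 (p. 7) and the proof of Prop. 2.3.4 (p. 12).
  [Temkin2008]
* U. Görtz, T. Wedhorn, *Algebraic Geometry I*, 2nd ed. (2020), Def. 13.90. [GortzWedhorn2020]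
-/

noncomputable section

open CategoryTheory CategoryTheory.Limits AlgebraicGeometry TopologicalSpace Opposite

namespace Literature.AlgebraicGeometry.Resolution

universe u

/-! ## Products of effective Cartier divisors -/

section Mul

variable {X : Scheme.{u}}

/-- Restricting a principal generator: if `K(V) = (g)` then `K(U) = (g|_U)` for affine opens
`U ⊆ V`. [folklore] -/
theorem ideal_eq_span_map_of_le (K : X.IdealSheafData) {U V : X.affineOpens}
    (h : (U : X.Opens) ≤ V) {g : Γ(X, V)} (hKV : K.ideal V = Ideal.span {g}) :
    K.ideal U = Ideal.span {X.presheaf.map (homOfLE h).op g} := by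
  rw [← K.map_ideal (U := U) (V := V) h, hKV, Ideal.map_span, Set.image_singleton]
  rfl

/-- **The product of two effective Cartier divisors is an effective Cartier divisor** (Stacks,
Tag 01WU: "The sum of two effective Cartier divisors is an effective Cartier divisor", the sum
being defined by the product of the ideal sheaves, Tag 01WT; proof: "Locally `f₁, f₂ ∈ A` are
nonzerodivisors, then also `f₁f₂ ∈ A` is a nonzerodivisor" — on a common affine neighbourhood).
[cite: StacksProject, Tag 01WU] -/
theorem IsEffectiveCartier.mul {I J : X.IdealSheafData} (hI : IsEffectiveCartier I)
    (hJ : IsEffectiveCartier J) : IsEffectiveCartier (I * J) := by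
  intro x
  obtain ⟨U, hxU, f, hf, hIU⟩ := hI x
  obtain ⟨V, hxV, g, hg, hJV⟩ := hJ x
  obtain ⟨W, hW, hxW, hWUV⟩ := exists_isAffineOpen_mem_and_subset (X := X) (x := x)
    (U := (U : X.Opens) ⊓ V) ⟨hxU, hxV⟩
  have hWU : W ≤ (U : X.Opens) := fun y hy => (hWUV hy).1
  have hWV : W ≤ (V : X.Opens) := fun y hy => (hWUV hy).2
  refine ⟨⟨W, hW⟩, hxW, X.presheaf.map (homOfLE hWU).op f * X.presheaf.map (homOfLE hWV).op g,
    mul_mem (map_mem_nonZeroDivisors_of_le (U := ⟨W, hW⟩) (V := U) hWU hf)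
      (map_mem_nonZeroDivisors_of_le (U := ⟨W, hW⟩) (V := V) hWV hg), ?_⟩
  rw [Scheme.IdealSheafData.ideal_mul, Pi.mul_apply,
    ideal_eq_span_map_of_le I (U := ⟨W, hW⟩) hWU hIU,
    ideal_eq_span_map_of_le J (U := ⟨W, hW⟩) hWV hJV, Ideal.span_singleton_mul_span_singleton]

/-- Powers of an effective Cartier divisor are effective Cartier divisors. [folklore] -/
theorem IsEffectiveCartier.pow {I : X.IdealSheafData} (hI : IsEffectiveCartier I) (n : ℕ) :
    IsEffectiveCartier (I ^ n) := by
  induction n with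
  | zero => rw [pow_zero, Scheme.IdealSheafData.one_eq_top]; exact isEffectiveCartier_top
  | succ n ih => rw [pow_succ]; exact ih.mul hI

end Mul

/-! ## A product of ideals which is invertible has invertible factors -/

section Factor

/-- **Algebra** (Stacks, Tag 09ME: "Let `A` be a ring. Let `I` and `J` be nonzero ideals of `A`
such that `IJ = (f)` for some nonzerodivisor `f ∈ A`. Then `I` and `J` are finitely generated
ideals and finitely locally free of rank `1` as `A`-modules"), in the explicit form of its proof,
which is what produces Cartier charts: there are finitely many `x_i ∈ I` and `c_i ∈ A` with
`∑ c_i = 1` such that in every localization `A[1/c_i]` the ideal `I` becomes principal, generated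
by the nonzerodivisor `x_i` ("write `f = ∑ x_i y_i` … `x_i y_i = a_i f` … `∑ a_i = 1` … if
`x' ∈ I`, then `x'y = af = axy` … Hence `x' = ax`"). (The hypothesis "nonzero" is not needed.)
[cite: StacksProject, Tag 09ME] -/
theorem Ideal.exists_local_generators_of_mul_eq_span {A : Type u} [CommRing A] {I J : Ideal A}
    {f : A} (hf : f ∈ nonZeroDivisors A) (h : I * J = Ideal.span {f}) :
    ∃ (ι : Type u) (_ : Fintype ι) (x c : ι → A), (∀ i, x i ∈ I) ∧ (∑ i, c i = 1) ∧
      ∀ (i : ι) (B : Type u) [CommRing B] [Algebra A B] [IsLocalization.Away (c i) B],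
        I.map (algebraMap A B) = Ideal.span {algebraMap A B (x i)} ∧
          algebraMap A B (x i) ∈ nonZeroDivisors B := by
  classical
  -- `f = ∑ x_i y_i`
  have hfmem : f ∈ I * J := by rw [h]; exact Ideal.mem_span_singleton_self f
  have hsum : ∃ (ι : Type u) (_ : Fintype ι) (x y : ι → A), (∀ i, x i ∈ I) ∧ (∀ i, y i ∈ J) ∧
      f = ∑ i, x i * y i := by
    refine Submodule.mul_induction_on (C := fun r => ∃ (ι : Type u) (_ : Fintype ι)
      (x y : ι → A), (∀ i, x i ∈ I) ∧ (∀ i, y i ∈ J) ∧ r = ∑ i, x i * y i) hfmem ?_ ?_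
    · intro m hm n hn
      exact ⟨PUnit, inferInstance, fun _ => m, fun _ => n, fun _ => hm, fun _ => hn, by simp⟩
    · rintro a b ⟨ι, _, x, y, hx, hy, rfl⟩ ⟨κ, _, x', y', hx', hy', rfl⟩
      refine ⟨ι ⊕ κ, inferInstance, Sum.elim x x', Sum.elim y y', ?_, ?_, ?_⟩
      · rintro (i | k); exacts [hx i, hx' k]
      · rintro (i | k); exacts [hy i, hy' k]
      · simp [Fintype.sum_sum_type]
  obtain ⟨ι, _, x, y, hx, hy, hfsum⟩ := hsum
  -- `x_i y_i = c_i f` and `∑ c_i = 1`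
  have hc : ∀ i, ∃ c : A, c * f = x i * y i := fun i =>
    Ideal.mem_span_singleton'.mp (h ▸ Ideal.mul_mem_mul (hx i) (hy i))
  choose c hc using hc
  have hc1 : ∑ i, c i = 1 := by
    have h1 : (∑ i, c i - 1) * f = 0 := by
      rw [sub_mul, one_mul, Finset.sum_mul]
      simp_rw [hc]
      rw [← hfsum, sub_self]
    exact sub_eq_zero.mp ((mem_nonZeroDivisors_iff_right.mp hf) _ h1)
  refine ⟨ι, inferInstance, x, c, hx, hc1, fun i B _ _ _ => ?_⟩
  -- in `A[1/c_i]`: `x_i y_i = c_i f` is a nonzerodivisor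
  have hfB : algebraMap A B f ∈ nonZeroDivisors B :=
    IsLocalization.nonZeroDivisors_le_comap (.powers (c i)) B hf
  have hci : IsUnit (algebraMap A B (c i)) := IsLocalization.Away.algebraMap_isUnit (c i)
  have hxy : algebraMap A B (x i) * algebraMap A B (y i) ∈ nonZeroDivisors B := by
    rw [← map_mul, ← hc, map_mul]
    exact mul_mem (hci.mem_nonZeroDivisors) hfB
  have hxi : algebraMap A B (x i) ∈ nonZeroDivisors B := (mul_mem_nonZeroDivisors.mp hxy).1
  have hyi : algebraMap A B (y i) ∈ nonZeroDivisors B := (mul_mem_nonZeroDivisors.mp hxy).2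
  refine ⟨le_antisymm ?_ ?_, hxi⟩
  · -- `x ∈ I`: `x y_i = e f = e c_i⁻¹ x_i y_i`, cancel `y_i`
    rw [Ideal.map_le_iff_le_comap]
    intro a ha
    rw [Ideal.mem_comap, Ideal.mem_span_singleton']
    obtain ⟨e, he⟩ : ∃ e : A, e * f = a * y i :=
      Ideal.mem_span_singleton'.mp (h ▸ Ideal.mul_mem_mul ha (hy i))
    obtain ⟨u, hu⟩ := hci
    refine ⟨algebraMap A B e * ↑u⁻¹, ?_⟩
    have key : (algebraMap A B e * ↑u⁻¹ * algebraMap A B (x i) - algebraMap A B a) *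
        algebraMap A B (y i) = 0 := by
      rw [sub_mul, sub_eq_zero]
      calc algebraMap A B e * ↑u⁻¹ * algebraMap A B (x i) * algebraMap A B (y i)
          = algebraMap A B e * (↑u⁻¹ * (algebraMap A B (x i) * algebraMap A B (y i))) := by ring
        _ = algebraMap A B e * (↑u⁻¹ * (↑u * algebraMap A B f)) := by
          rw [← map_mul (algebraMap A B) (x i), ← hc, map_mul, hu]
        _ = algebraMap A B (a * y i) := by rw [Units.inv_mul_cancel_left, ← map_mul, he]
        _ = algebraMap A B a * algebraMap A B (y i) := map_mul _ _ _
    exact sub_eq_zero.mp (mem_nonZeroDivisors_iff_right.mp hyi _ key)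
  · rw [Ideal.span_singleton_le_iff_mem]
    exact Ideal.mem_map_of_mem _ (hx i)

variable {X : Scheme.{u}}

/-- **If a product of two (quasi-coherent) ideal sheaves is an effective Cartier divisor, so is
each factor** (Stacks, Tag 07ZV: "Let `Z, Y` be two closed subschemes of `X` with ideal sheaves
`𝓘` and `𝓙`. If `𝓘𝓙` defines an effective Cartier divisor `D ⊂ X`, then `Z` and `Y` are
effective Cartier divisors and `D = Z + Y`"; no finiteness hypotheses), by Tag 09ME on a Cartier
chart `W` of `𝓘𝓙`: with `∑ c_i = 1` some `c_i` does not vanish at the given point, and on the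
basic open `D(c_i) ⊆ W` the ideal `𝓘` is generated by the nonzerodivisor `x_i`.
[cite: StacksProject, Tag 07ZV] -/
theorem IsEffectiveCartier.of_mul_left {I J : X.IdealSheafData} (h : IsEffectiveCartier (I * J)) :
    IsEffectiveCartier I := by
  classical
  intro x
  obtain ⟨W, hxW, f, hf, hW⟩ := h x
  rw [Scheme.IdealSheafData.ideal_mul, Pi.mul_apply] at hW
  obtain ⟨ι, _, a, c, ha, hc1, hloc⟩ := Ideal.exists_local_generators_of_mul_eq_span hf hW
  -- some `c i` does not vanish at `x`, since `∑ c i = 1`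
  obtain ⟨i, hi⟩ : ∃ i, x ∈ X.basicOpen (c i) := by
    by_contra hall
    push Not at hall
    have hmem : ∀ i, X.presheaf.germ W x hxW (c i) ∈
        IsLocalRing.maximalIdeal (X.presheaf.stalk x) := fun i =>
      (IsLocalRing.mem_maximalIdeal _).mpr fun hu => hall i ((X.mem_basicOpen (c i) x hxW).mpr hu)
    have h1 : X.presheaf.germ W x hxW (∑ i, c i) ∈ IsLocalRing.maximalIdeal (X.presheaf.stalk x) := by
      rw [map_sum]
      exact Ideal.sum_mem _ fun i _ => hmem i
    rw [hc1, map_one] at h1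
    exact (IsLocalRing.maximalIdeal.isMaximal _).ne_top (Ideal.eq_top_of_isUnit_mem _ h1 isUnit_one)
  haveI := W.2.isLocalization_basicOpen (c i)
  obtain ⟨hmap, hnzd⟩ := hloc i Γ(X, X.basicOpen (c i))
  refine ⟨X.affineBasicOpen (c i), hi, algebraMap Γ(X, W) Γ(X, X.basicOpen (c i)) (a i), hnzd, ?_⟩
  exact (I.map_ideal (U := X.affineBasicOpen (c i)) (V := W) (X.basicOpen_le (c i))).symm.trans hmap

/-- If `I * J` is an effective Cartier divisor then so is `J`. [cite: StacksProject, Tag 07ZV] -/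
theorem IsEffectiveCartier.of_mul_right {I J : X.IdealSheafData} (h : IsEffectiveCartier (I * J)) :
    IsEffectiveCartier J :=
  IsEffectiveCartier.of_mul_left (I := J) (J := I) (by rwa [mul_comm])

end Factor

/-! ## Regular sections restrict to regular sections on opens of an affine open -/

section Restrict

variable {X : Scheme.{u}}

/-- A nonzerodivisor of the coordinate ring of an affine open `U` restricts to a nonzerodivisor of
`Γ(X, O)` for every open `O ⊆ U` (on each basic open `D(g) ⊆ O` the sections are the
localization `Γ(X, U)[1/g]`, and a section vanishing on a cover vanishes). [folklore] -/
theorem map_mem_nonZeroDivisors_of_le_affine {U : X.affineOpens} {O : X.Opens}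
    (hO : O ≤ (U : X.Opens)) {l : Γ(X, U)} (hl : l ∈ nonZeroDivisors Γ(X, U)) :
    X.presheaf.map (homOfLE hO).op l ∈ nonZeroDivisors Γ(X, O) := by
  rw [mem_nonZeroDivisors_iff_right]
  intro s hs
  apply X.IsSheaf.section_ext
  intro y hy
  obtain ⟨g, hgO, hyg⟩ := U.2.exists_basicOpen_le ⟨y, hy⟩ (hO hy)
  refine ⟨X.basicOpen g, hgO, hyg, ?_⟩
  haveI := U.2.isLocalization_basicOpen g
  rw [map_zero]
  have hl' : algebraMap Γ(X, U) Γ(X, X.basicOpen g) l ∈ nonZeroDivisors _ :=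
    IsLocalization.nonZeroDivisors_le_comap (.powers g) _ hl
  refine (mem_nonZeroDivisors_iff_right.mp hl') _ ?_
  have := congrArg (X.presheaf.map (homOfLE hgO).op) hs
  rw [map_mul, map_zero] at this
  convert this using 2
  change X.presheaf.map _ l = (X.presheaf.map _ ≫ X.presheaf.map _) l
  rw [← X.presheaf.map_comp]
  rfl

/-- A nonzerodivisor pulls back to a nonzerodivisor along an injective ring homomorphism… in the
converse direction: if `φ` is injective and `φ a` is a nonzerodivisor then so is `a`. [folklore] -/
theorem mem_nonZeroDivisors_of_injective {A B : Type*} [CommRing A] [CommRing B] {φ : A →+* B}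
    (hφ : Function.Injective φ) {a : A} (ha : φ a ∈ nonZeroDivisors B) : a ∈ nonZeroDivisors A := by
  rw [mem_nonZeroDivisors_iff_right]
  intro t ht
  apply hφ
  rw [map_zero]
  exact (mem_nonZeroDivisors_iff_right.mp ha) _ (by rw [← map_mul, ht, map_zero])

end Restrict

/-! ## Effective Cartier divisors pull back along blowing ups -/

section PullbackCartier

variable {X' X : Scheme.{u}} {π : X' ⟶ X} {J : X.IdealSheafData}

/-- **Effective Cartier divisors pull back to effective Cartier divisors along a blowing up**
(Stacks, Tag 0809: "Let `b : X' → X` be a blowup of `X` in a closed subscheme. The pullback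
`b⁻¹D` is defined for all effective Cartier divisors `D ⊂ X`", i.e. (Def. 01WV) the local
equations of `D` pull back to regular elements). Stacks proves it on the affine blowup algebras
("the image of `x` in `A[I/a]` is a nonzerodivisor"); here from the universal property alone:
on a Cartier chart `W₁` of the exceptional divisor with equation `f₁`, `Γ(W₁) ↪ Γ(D(f₁))`
(`f₁` is regular), and `D(f₁)` lies over the complement of the centre, where `π` is an open
immersion (`IsBlowup.isOpenImmersion_preimage_compl_ι`), so `Γ(D(f₁))` is the ring of sections
of `X` over an open subset of a Cartier chart of `D`, in which the local equation of `D` stays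
regular (`map_mem_nonZeroDivisors_of_le_affine`). [cite: StacksProject, Tag 0809] -/
theorem IsEffectiveCartier.comap_of_isBlowup (hπ : IsBlowup π J) {L : X.IdealSheafData}
    (hL : IsEffectiveCartier L) : IsEffectiveCartier (L.comap π) := by
  intro x'
  obtain ⟨W, hxW, f, hf, hEW⟩ := hπ.isEffectiveCartier x'
  obtain ⟨U, hxU, l, hl, hLU⟩ := hL (π x')
  obtain ⟨W₁', hW₁, hxW₁, hW₁le⟩ := exists_isAffineOpen_mem_and_subset (X := X') (x := x')
    (U := (W : X'.Opens) ⊓ π ⁻¹ᵁ (U : X.Opens)) ⟨hxW, hxU⟩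
  let W₁ : X'.affineOpens := ⟨W₁', hW₁⟩
  have h₁W : (W₁ : X'.Opens) ≤ W := fun y hy => (hW₁le hy).1
  have h₁U : (W₁ : X'.Opens) ≤ π ⁻¹ᵁ (U : X.Opens) := fun y hy => (hW₁le hy).2
  let f₁ : Γ(X', W₁) := X'.presheaf.map (homOfLE h₁W).op f
  have hf₁ : f₁ ∈ nonZeroDivisors Γ(X', W₁) := map_mem_nonZeroDivisors_of_le h₁W hf
  have hEW₁ : (J.comap π).ideal W₁ = Ideal.span {f₁} := ideal_eq_span_map_of_le _ h₁W hEW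
  let l₁ : Γ(X', W₁) := π.appLE U W₁ h₁U l
  have hLW₁ : (L.comap π).ideal W₁ = Ideal.span {l₁} := by
    rw [ideal_comap_of_le π L U W₁ h₁U, hLU, Ideal.map_span, Set.image_singleton]
  refine ⟨W₁, hxW₁, l₁, ?_, hLW₁⟩
  -- `D(f₁)` lies over the complement of the centre, where `π` is an open immersion
  let D : X'.Opens := X'.basicOpen f₁
  have hDW₁ : D ≤ (W₁ : X'.Opens) := X'.basicOpen_le f₁
  let V : X'.Opens := π ⁻¹ᵁ centreCompl J
  have hDV : D ≤ V := IsBlowup.basicOpen_le_preimage_compl W₁ f₁ hEW₁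
  let F : (V : Scheme.{u}) ⟶ X := V.ι ≫ π
  haveI : IsOpenImmersion F := hπ.isOpenImmersion_preimage_compl_ι
  let B : (V : Scheme.{u}).Opens := V.ι ⁻¹ᵁ D
  let O : X.Opens := F ''ᵁ B
  have hOU : O ≤ (U : X.Opens) := by
    rintro _ ⟨v, hv, rfl⟩
    exact h₁U (hDW₁ hv)
  have hBO : B ≤ F ⁻¹ᵁ O := (F.preimage_image_eq B).ge
  -- `l|_O` is a nonzerodivisor of `Γ(X, O)`
  have hlO : X.presheaf.map (homOfLE hOU).op l ∈ nonZeroDivisors Γ(X, O) :=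
    map_mem_nonZeroDivisors_of_le_affine hOU hl
  -- `Γ(X, O) ≅ Γ(V, B) ≅ Γ(X', D)`
  haveI h1 : IsIso (V.ι.app D) := V.ι.isIso_app D (by rw [Scheme.Opens.opensRange_ι]; exact hDV)
  let φ : Γ(X, O) →+* Γ(X', D) := (inv (V.ι.app D)).hom.comp (F.appIso B).hom.hom
  let ψ : Γ(X', D) →+* Γ(X, O) := (F.appIso B).inv.hom.comp (V.ι.app D).hom
  have hφψ : ∀ a, ψ (φ a) = a := fun a => by
    change ((F.appIso B).hom ≫ inv (V.ι.app D) ≫ V.ι.app D ≫ (F.appIso B).inv).hom a = a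
    rw [IsIso.inv_hom_id_assoc, Iso.hom_inv_id]
    rfl
  have hψφ : ∀ b, φ (ψ b) = b := fun b => by
    change ((V.ι.app D ≫ (F.appIso B).inv) ≫ (F.appIso B).hom ≫ inv (V.ι.app D)).hom b = b
    rw [Category.assoc, Iso.inv_hom_id_assoc, IsIso.hom_inv_id]
    rfl
  -- under which `l|_O ↦ l₁|_D`
  have hlD : φ (X.presheaf.map (homOfLE hOU).op l) = algebraMap Γ(X', W₁) Γ(X', D) l₁ := by
    have hinjD : Function.Injective (V.ι.app D) := (ConcreteCategory.bijective_of_isIso _).1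
    apply hinjD
    change ((F.appIso B).hom ≫ inv (V.ι.app D) ≫ V.ι.app D).hom (X.presheaf.map (homOfLE hOU).op l) =
      (π.appLE U W₁ h₁U ≫ X'.presheaf.map (homOfLE hDW₁).op ≫ V.ι.app D).hom l
    rw [IsIso.inv_hom_id, Category.comp_id, Scheme.Hom.appIso_hom',
      ← CommRingCat.comp_apply, Scheme.Hom.map_appLE, Scheme.Hom.appLE_map_assoc,
      Scheme.Hom.app_eq_appLE, Scheme.Hom.appLE_comp_appLE]
  have key : algebraMap Γ(X', W₁) Γ(X', D) l₁ ∈ nonZeroDivisors Γ(X', D) := by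
    rw [← hlD]
    exact mem_nonZeroDivisors_of_inverse φ ψ hφψ hψφ hlO
  -- finally `Γ(W₁) → Γ(D(f₁))` is injective (`f₁` regular)
  haveI := hW₁.isLocalization_basicOpen f₁
  exact mem_nonZeroDivisors_of_injective
    (IsLocalization.injective (M := Submonoid.powers f₁) Γ(X', D) (Submonoid.powers_le.mpr hf₁)) key

end PullbackCartier

/-! ## Twisting the centre by an effective Cartier divisor; blowing up in a product -/

section Product

/-- **Twisting the centre by an effective Cartier divisor does not change the blowing up**: if
`π` is a blowing up of `X` along `K` and `L` is an effective Cartier divisor on `X`, then `π` is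
also a blowing up of `X` along `K · L` (the step "this will prove what we want as `𝓘_E^d` cuts
out the effective Cartier divisor `dE` and we can use Lemmas 0807 and 080A" of Stacks, Tag 080B):
`π⁻¹(K·L) = π⁻¹K · π⁻¹L` is effective Cartier since `π⁻¹L` is (Tag 0809, Tag 01WU), and a
morphism pulling `K·L` back to an effective Cartier divisor pulls `K` back to one (Tag 07ZV).
[cite: StacksProject, Tag 080B (proof)] -/
theorem IsBlowup.mul_of_isEffectiveCartier {X' X : Scheme.{u}} {π : X' ⟶ X}
    {K L : X.IdealSheafData} (hπ : IsBlowup π K) (hL : IsEffectiveCartier L) :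
    IsBlowup π (K * L) := by
  constructor
  · rw [comap_mul]
    exact hπ.isEffectiveCartier.mul (hL.comap_of_isBlowup hπ)
  · intro W f hf
    rw [comap_mul] at hf
    exact hπ.universal f hf.of_mul_left

/-- **Blowing up in a product of ideals** (Stacks, Tag 080A: "Let `b : X' → X` be the blowing
up of `X` in `𝓘`. Let `b' : X'' → X'` be the blowing up of `X'` in `b⁻¹𝓙 𝒪_{X'}`. Then
`X'' → X` is canonically isomorphic to the blowing up of `X` in `𝓘𝓙`"), for blowing ups in
the sense of the universal property: if `p` is a blowing up of `Y` along `P` and `p'` a blowing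
up of `Y'` along `p⁻¹R 𝒪_{Y'}`, then `p' ≫ p` is a blowing up of `Y` along `P · R`. The
exceptional divisor is `p'⁻¹(E_P) + E_{p⁻¹R}` ("Then `(b')⁻¹E` is an effective Cartier divisor on
`X''` by Lemma 0809 … Consider the effective Cartier divisor `E'' = E' + (b')⁻¹E`"); universality
("as `𝓘𝓙` pulls back to an invertible ideal we see that `c⁻¹𝓘𝒪_Y` defines an effective Cartier
divisor, see Lemma 07ZV. Thus a morphism `c' : Y → X'` over `X` … Thus a morphism
`c'' : Y → X''` over `X'`") by Tag 07ZV and the two universal properties; Stacks "omit[s] the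
verification that this morphism is inverse to the morphism `X'' → Y` constructed earlier", which
in the universal-property formulation is the uniqueness clause proved here.
[cite: StacksProject, Tag 080A] -/
theorem IsBlowup.comp {Y'' Y' Y : Scheme.{u}} {p : Y' ⟶ Y} {P : Y.IdealSheafData}
    {p' : Y'' ⟶ Y'} {R : Y.IdealSheafData} (hp : IsBlowup p P) (hp' : IsBlowup p' (R.comap p)) :
    IsBlowup (p' ≫ p) (P * R) := by
  constructor
  · rw [comap_mul, Scheme.IdealSheafData.comap_comp, Scheme.IdealSheafData.comap_comp]
    exact (hp.isEffectiveCartier.comap_of_isBlowup hp').mul hp'.isEffectiveCartier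
  · intro W w hw
    rw [comap_mul] at hw
    obtain ⟨w₁, hw₁, hu₁⟩ := hp.universal w hw.of_mul_left
    have hR : IsEffectiveCartier ((R.comap p).comap w₁) := by
      rw [← Scheme.IdealSheafData.comap_comp, hw₁]
      exact hw.of_mul_right
    obtain ⟨w₂, hw₂, hu₂⟩ := hp'.universal w₁ hR
    refine ⟨w₂, show w₂ ≫ p' ≫ p = w by rw [← Category.assoc, hw₂, hw₁], fun v hv => ?_⟩
    have hv' : (v ≫ p') ≫ p = w := by rw [Category.assoc]; exact hv
    exact hu₂ _ (hu₁ _ hv')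

end Product

end Literature.AlgebraicGeometry.Resolution

end
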